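import Mathlib
import Summits.Ventures.PercRepro2.Defs
import Summits.Ventures.PercRepro2.Independence
import Summits.Ventures.PercRepro2.Harris
import Summits.Ventures.PercRepro2.Graph
import Summits.Ventures.PercRepro2.Exploration
import Summits.Ventures.PercRepro2.Events
import Summits.Ventures.PercRepro2.ObsIndependence
import Summits.Ventures.PercRepro2.BHKEvents
import Summits.Ventures.PercRepro2.ZCPendantSecondOrder
import Summits.Ventures.PercRepro2.CDRequired
import Summits.Ventures.PercRepro2.PocketConn
import Summits.Ventures.PercRepro2.CutVertexDefs
import Summits.Ventures.PercRepro2.CDCutVertex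

/-!
# Row 2′CD when `a₃` lies in a root-only pocket — every up-set (blind cell PercRepro2, mine-a g33;
MINE-A.md §88.10)

A root-only pocket `P` (`PocketConn.IsPocket ends P a₁ a₂`, night-1: every edge leaving `P` ends at a
root) with `a₃ ∈ P`, the roots and `o` outside.  Then row 2′CD holds for EVERY up-set `𝓔` of vertex
sets and every weight vector (`cd_of_pocket`) — mine-a g11's Theorem B / mine-c's `cd_of_two_root`
without the restriction that the up-set be read outside the pocket.

Proof.  By `CDRequired.cd_of_required_anticorr` it suffices to prove the `a₃`-required
anti-correlation `P(Q U e f) · P(Q e) ≤ P(Q U e) · P(Q e f)`.  On `Q = {a₁ ↮ a₂}` the pocket is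
invisible to the outside (`PocketConn`, Lemmas 1–2): `Q` splits as `{a₁ ↮ a₂ in P} ∩ {a₁ ↮ a₂ outside}`
(`conn_iff_pocket_or_outside`), `e = {a₁ ↔ a₃ in P}`, `f = {a₂ ↔ o outside}`, and the root cluster is
`C_P(a₁) ∪ C_out(a₁)` (`cluster_eq_pocket_union_outside`).  Conditioning on the pocket configuration
`T` (the tower `CDCutVertex.prob_eq_sum_tower`, the pocket edges `touches ends P` and the outside
edges being independent), each of the four probabilities is `∑_ω weight p ω · 1_{a₁ ↔ a₃, a₁ ↮ a₂ in P}(T)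
· P_p(outside event)`, the outside events being those of BHK06 Thm 1.4 with the root `a₁` and the
up-set `𝓔_T = {W ∣ C_P(a₁)(T) ∪ W ∈ 𝓔}` (`required_events_eq_pocket`); an outside probability is a
probability under the weight vector with the pocket edges closed
(`CDCutVertex.prob_zeroOff_eq_prob_sideEvent`), where `bhk_cross_cluster` is the fibrewise
inequality (`outside_anticorr`); the factors `P(Q e)`, `P(Q e f)` do not depend on `T`, so the
fibrewise inequalities add up.  In the lens: the `a₃`-first revealment of `C₁` is confined to the
pocket, and the between-fibre covariance vanishes.  No definition; one seat.
-/

namespace Summit.Ventures.PercRepro2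

namespace CDPocket

section Main

variable {V : Type*} {E : Type*} [Fintype E] [DecidableEq E] [Fintype V] [DecidableEq V]
  {R : Type*} [Field R] [LinearOrder R] [IsStrictOrderedRing R]

variable {ends : E → Sym2 V} {P : Set V} {a₁ a₂ : V} [DecidablePred (· ∈ touches ends P)]
  [DecidablePred (· ∈ (touches ends P)ᶜ)]

omit [Fintype E] [DecidableEq E] [Fintype V] [DecidableEq V] in
/-- **The roots are separated iff they are separated inside the pocket and outside it.** -/
lemma conn_iff_pocket_or_outside (hP : PocketConn.IsPocket ends P a₁ a₂) (h1 : a₁ ∉ P)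
    (h2 : a₂ ∉ P) (ω : Config E) :
    Conn ends ω a₁ a₂ ↔
      Conn ends (restrict (touches ends P) ω) a₁ a₂ ∨
        Conn ends (restrict (touches ends P)ᶜ ω) a₁ a₂ := by
  constructor
  · intro h
    by_contra hcon
    push Not at hcon
    obtain ⟨hin, hout⟩ := hcon
    -- the closed set: outside vertices reached by outside edges, pocket vertices reached inside
    let S : Set V := {x | x ∉ P ∧ Conn ends (restrict (touches ends P)ᶜ ω) a₁ x} ∪
      {x | x ∈ P ∧ Conn ends (restrict (touches ends P) ω) a₁ x}
    have hS : ∀ x ∈ S, ∀ y, (openGraph ends ω).Adj x y → y ∈ S := by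
      intro x hx y hxy
      obtain ⟨_, e, he, hends⟩ := openGraph_adj.1 hxy
      by_cases hyP : y ∈ P
      · -- `y` in the pocket: the edge touches `P`, and `x` is in `P` or a root
        rcases hP.other hends hyP with hxP | hxa₁ | hxa₂
        · rcases hx with ⟨hx', _⟩ | ⟨_, hx'⟩
          · exact absurd hxP hx'
          · exact Or.inr ⟨hyP, conn_trans hx'
              (conn_of_openAdj (PocketConn.openAdj_restrict_touches he hends (Or.inl hxP)))⟩
        · subst hxa₁
          exact Or.inr ⟨hyP, conn_of_openAdj
            (PocketConn.openAdj_restrict_touches he hends (Or.inr hyP))⟩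
        · subst hxa₂
          rcases hx with ⟨_, hx'⟩ | ⟨hx', _⟩
          · exact absurd hx' hout
          · exact absurd hx' h2
      · -- `y` outside: either `x` is outside too (an outside edge) or `x ∈ P` and `y` is a root
        by_cases hxP : x ∈ P
        · rcases hP e x y hends hxP with hyP' | hya₁ | hya₂
          · exact absurd hyP' hyP
          · rw [hya₁]
            exact Or.inl ⟨h1, conn_refl _ _ _⟩
          · have hxy : Conn ends (restrict (touches ends P) ω) x y :=
              conn_of_openAdj (PocketConn.openAdj_restrict_touches he hends (Or.inl hxP))
            rw [hya₂] at hxy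
            rcases hx with ⟨hx', _⟩ | ⟨_, hx'⟩
            · exact absurd hxP hx'
            · exact absurd (conn_trans hx' hxy) hin
        · rcases hx with ⟨_, hx'⟩ | ⟨hx', _⟩
          · exact Or.inl ⟨hyP, conn_trans hx'
              (conn_of_openAdj (PocketConn.openAdj_restrict_compl he hends hxP hyP))⟩
          · exact absurd hx' hxP
    have ha₁ : a₁ ∈ S := Or.inl ⟨h1, conn_refl _ _ _⟩
    rcases mem_of_conn_of_closed hS ha₁ h with ⟨_, h'⟩ | ⟨h', _⟩
    · exact hout h'
    · exact h2 h'
  · rintro (h | h)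
    · exact conn_mono (restrict_le _ ω) h
    · exact conn_mono (restrict_le _ ω) h

omit [Fintype E] [DecidableEq E] [Fintype V] [DecidableEq V] in
/-- On `Q`, the root cluster is the pocket cluster of `a₁` together with its outside cluster. -/
lemma cluster_eq_pocket_union_outside (hP : PocketConn.IsPocket ends P a₁ a₂) (h1 : a₁ ∉ P)
    {ω : Config E} (hQ : ¬ Conn ends ω a₁ a₂) :
    cluster ends ω a₁ = cluster ends (restrict (touches ends P) ω) a₁ ∪
      cluster ends (restrict (touches ends P)ᶜ ω) a₁ := by
  ext v
  constructor
  · intro hv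
    by_cases hvP : v ∈ P
    · exact Or.inl (conn_symm
        ((PocketConn.conn_root_iff_conn_restrict hP hQ (Or.inl rfl) hvP).1 hv))
    · exact Or.inr ((PocketConn.conn_iff_conn_restrict hP hQ h1 hvP).1 hv)
  · rintro (hv | hv)
    · exact conn_mono (restrict_le _ ω) hv
    · exact conn_mono (restrict_le _ ω) hv

omit [Fintype E] [DecidableEq E] [Fintype V] [DecidableEq V] in
/-- The four `a₃`-required events, read on the pocket and on the outside: the pocket event
`{a₁ ↔ a₃ in P} ∩ {a₁ ↮ a₂ in P}` and the outside events of BHK06 Thm 1.4 with the root `a₁` and the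
up-set `𝓔_T = {W ∣ C_P(a₁)(T) ∪ W ∈ 𝓔}`. -/
lemma required_events_eq_pocket (hP : PocketConn.IsPocket ends P a₁ a₂) (h1 : a₁ ∉ P)
    (h2 : a₂ ∉ P) {a₃ o : V} (ha₃ : a₃ ∈ P) (ho : o ∉ P) (𝓔 : Set (Set V)) :
    ((connEvent ends a₁ a₂)ᶜ ∩ clusterInEvent ends a₁ 𝓔 ∩ connEvent ends a₁ a₃ ∩
        connEvent ends a₂ o =
      {ω | restrict (touches ends P) ω ∈ (connEvent ends a₁ a₃ ∩ (connEvent ends a₁ a₂)ᶜ) ∧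
        restrict (touches ends P)ᶜ ω ∈
          (clusterInEvent ends a₁ {W | cluster ends (restrict (touches ends P) ω) a₁ ∪ W ∈ 𝓔} ∩
            connEvent ends a₂ o ∩ (connEvent ends a₁ a₂)ᶜ)}) ∧
    ((connEvent ends a₁ a₂)ᶜ ∩ connEvent ends a₁ a₃ =
      {ω | restrict (touches ends P) ω ∈ (connEvent ends a₁ a₃ ∩ (connEvent ends a₁ a₂)ᶜ) ∧
        restrict (touches ends P)ᶜ ω ∈ (connEvent ends a₁ a₂)ᶜ}) ∧
    ((connEvent ends a₁ a₂)ᶜ ∩ clusterInEvent ends a₁ 𝓔 ∩ connEvent ends a₁ a₃ =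
      {ω | restrict (touches ends P) ω ∈ (connEvent ends a₁ a₃ ∩ (connEvent ends a₁ a₂)ᶜ) ∧
        restrict (touches ends P)ᶜ ω ∈
          (clusterInEvent ends a₁ {W | cluster ends (restrict (touches ends P) ω) a₁ ∪ W ∈ 𝓔} ∩
            (connEvent ends a₁ a₂)ᶜ)}) ∧
    ((connEvent ends a₁ a₂)ᶜ ∩ connEvent ends a₁ a₃ ∩ connEvent ends a₂ o =
      {ω | restrict (touches ends P) ω ∈ (connEvent ends a₁ a₃ ∩ (connEvent ends a₁ a₂)ᶜ) ∧
        restrict (touches ends P)ᶜ ω ∈ (connEvent ends a₂ o ∩ (connEvent ends a₁ a₂)ᶜ)}) := by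
  have hQ : ∀ ω : Config E, ¬ Conn ends ω a₁ a₂ ↔
      (¬ Conn ends (restrict (touches ends P) ω) a₁ a₂ ∧
        ¬ Conn ends (restrict (touches ends P)ᶜ ω) a₁ a₂) := by
    intro ω
    rw [conn_iff_pocket_or_outside hP h1 h2 ω]
    tauto
  have hE : ∀ ω : Config E, ¬ Conn ends ω a₁ a₂ →
      (Conn ends ω a₁ a₃ ↔ Conn ends (restrict (touches ends P) ω) a₁ a₃) := by
    intro ω hq
    rw [PocketConn.conn_root_iff_conn_restrict hP hq (Or.inl rfl) ha₃]
    exact ⟨conn_symm, conn_symm⟩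
  have hF : ∀ ω : Config E, ¬ Conn ends ω a₁ a₂ →
      (Conn ends ω a₂ o ↔ Conn ends (restrict (touches ends P)ᶜ ω) a₂ o) :=
    fun ω hq => PocketConn.conn_iff_conn_restrict hP hq h2 ho
  have hU : ∀ ω : Config E, ¬ Conn ends ω a₁ a₂ →
      (cluster ends ω a₁ ∈ 𝓔 ↔
        cluster ends (restrict (touches ends P) ω) a₁ ∪
          cluster ends (restrict (touches ends P)ᶜ ω) a₁ ∈ 𝓔) :=
    fun ω hq => by rw [cluster_eq_pocket_union_outside hP h1 hq]
  refine ⟨?_, ?_, ?_, ?_⟩ <;> ext ω <;>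
    simp only [Set.mem_inter_iff, Set.mem_compl_iff, mem_connEvent, mem_clusterInEvent,
      Set.mem_setOf_eq]
  · constructor
    · rintro ⟨⟨⟨hq, hu⟩, he⟩, hf⟩
      obtain ⟨hqP, hqO⟩ := (hQ ω).1 hq
      exact ⟨⟨(hE ω hq).1 he, hqP⟩, ⟨⟨(hU ω hq).1 hu, (hF ω hq).1 hf⟩, hqO⟩⟩
    · rintro ⟨⟨he, hqP⟩, ⟨⟨hu, hf⟩, hqO⟩⟩
      have hq : ¬ Conn ends ω a₁ a₂ := (hQ ω).2 ⟨hqP, hqO⟩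
      exact ⟨⟨⟨hq, (hU ω hq).2 hu⟩, (hE ω hq).2 he⟩, (hF ω hq).2 hf⟩
  · constructor
    · rintro ⟨hq, he⟩
      obtain ⟨hqP, hqO⟩ := (hQ ω).1 hq
      exact ⟨⟨(hE ω hq).1 he, hqP⟩, hqO⟩
    · rintro ⟨⟨he, hqP⟩, hqO⟩
      have hq : ¬ Conn ends ω a₁ a₂ := (hQ ω).2 ⟨hqP, hqO⟩
      exact ⟨hq, (hE ω hq).2 he⟩
  · constructor
    · rintro ⟨⟨hq, hu⟩, he⟩
      obtain ⟨hqP, hqO⟩ := (hQ ω).1 hq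
      exact ⟨⟨(hE ω hq).1 he, hqP⟩, ⟨(hU ω hq).1 hu, hqO⟩⟩
    · rintro ⟨⟨he, hqP⟩, ⟨hu, hqO⟩⟩
      have hq : ¬ Conn ends ω a₁ a₂ := (hQ ω).2 ⟨hqP, hqO⟩
      exact ⟨⟨hq, (hU ω hq).2 hu⟩, (hE ω hq).2 he⟩
  · constructor
    · rintro ⟨⟨hq, he⟩, hf⟩
      obtain ⟨hqP, hqO⟩ := (hQ ω).1 hq
      exact ⟨⟨(hE ω hq).1 he, hqP⟩, ⟨(hF ω hq).1 hf, hqO⟩⟩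
    · rintro ⟨⟨he, hqP⟩, ⟨hf, hqO⟩⟩
      have hq : ¬ Conn ends ω a₁ a₂ := (hQ ω).2 ⟨hqP, hqO⟩
      exact ⟨⟨hq, (hE ω hq).2 he⟩, (hF ω hq).2 hf⟩

omit [DecidablePred (· ∈ touches ends P)] in
/-- **The fibrewise inequality on the outside**: BHK06 Thm 1.4 for the root `a₁` against `{o ∈ C₂}`
with the pocket edges closed, read as outside probabilities. -/
theorem outside_anticorr (p : E → R) (hp : IsProbVec p) {𝓤 : Set (Set V)} (h𝓤 : IsUpperSet 𝓤)
    (o : V) :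
    prob p (CutV.sideEvent (touches ends P)ᶜ (clusterInEvent ends a₁ 𝓤 ∩ connEvent ends a₂ o ∩
        (connEvent ends a₁ a₂)ᶜ)) *
      prob p (CutV.sideEvent (touches ends P)ᶜ (connEvent ends a₁ a₂)ᶜ) ≤
    prob p (CutV.sideEvent (touches ends P)ᶜ (clusterInEvent ends a₁ 𝓤 ∩ (connEvent ends a₁ a₂)ᶜ)) *
      prob p (CutV.sideEvent (touches ends P)ᶜ (connEvent ends a₂ o ∩ (connEvent ends a₁ a₂)ᶜ)) := by
  rw [← CDCutVertex.prob_zeroOff_eq_prob_sideEvent, ← CDCutVertex.prob_zeroOff_eq_prob_sideEvent,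
    ← CDCutVertex.prob_zeroOff_eq_prob_sideEvent, ← CDCutVertex.prob_zeroOff_eq_prob_sideEvent]
  have key := bhk_cross_cluster (fun e => if e ∈ (touches ends P)ᶜ then p e else 0)
    (CDCutVertex.isProbVec_zeroOff hp _) ends a₁ a₂ h𝓤 (ZCPendant.isUpperSet_mem_o (V := V) o)
  rwa [ZCPendant.clusterInEvent_mem_o_eq] at key

/-- **The `a₃`-required anti-correlation for `a₃` in a root-only pocket.** -/
theorem required_anticorr_of_pocket (p : E → R) (hp : IsProbVec p)
    (hP : PocketConn.IsPocket ends P a₁ a₂) (h1 : a₁ ∉ P) (h2 : a₂ ∉ P) {a₃ o : V}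
    (ha₃ : a₃ ∈ P) (ho : o ∉ P) {𝓔 : Set (Set V)} (h𝓔 : IsUpperSet 𝓔) :
    prob p ((connEvent ends a₁ a₂)ᶜ ∩ clusterInEvent ends a₁ 𝓔 ∩ connEvent ends a₁ a₃ ∩
          connEvent ends a₂ o) * prob p ((connEvent ends a₁ a₂)ᶜ ∩ connEvent ends a₁ a₃) ≤
      prob p ((connEvent ends a₁ a₂)ᶜ ∩ clusterInEvent ends a₁ 𝓔 ∩ connEvent ends a₁ a₃) *
        prob p ((connEvent ends a₁ a₂)ᶜ ∩ connEvent ends a₁ a₃ ∩ connEvent ends a₂ o) := by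
  obtain ⟨e1, e2, e3, e4⟩ := required_events_eq_pocket hP h1 h2 ha₃ ho 𝓔
  have hdisj : Disjoint (touches ends P) (touches ends P)ᶜ := disjoint_compl_right
  have t1 := CDCutVertex.prob_eq_sum_tower p (touches ends P) (touches ends P)ᶜ hdisj
    (connEvent ends a₁ a₃ ∩ (connEvent ends a₁ a₂)ᶜ) (fun T =>
      clusterInEvent ends a₁ {W | cluster ends T a₁ ∪ W ∈ 𝓔} ∩ connEvent ends a₂ o ∩
        (connEvent ends a₁ a₂)ᶜ)
  have t2 := CDCutVertex.prob_eq_sum_tower p (touches ends P) (touches ends P)ᶜ hdisj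
    (connEvent ends a₁ a₃ ∩ (connEvent ends a₁ a₂)ᶜ) (fun _ => (connEvent ends a₁ a₂)ᶜ)
  have t3 := CDCutVertex.prob_eq_sum_tower p (touches ends P) (touches ends P)ᶜ hdisj
    (connEvent ends a₁ a₃ ∩ (connEvent ends a₁ a₂)ᶜ) (fun T =>
      clusterInEvent ends a₁ {W | cluster ends T a₁ ∪ W ∈ 𝓔} ∩ (connEvent ends a₁ a₂)ᶜ)
  have t4 := CDCutVertex.prob_eq_sum_tower p (touches ends P) (touches ends P)ᶜ hdisj
    (connEvent ends a₁ a₃ ∩ (connEvent ends a₁ a₂)ᶜ)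
    (fun _ => connEvent ends a₂ o ∩ (connEvent ends a₁ a₂)ᶜ)
  rw [e1, e3, e4, e2, t1, t3, t4, t2]
  set w : Config E → R := fun ω => weight p ω *
    (connEvent ends a₁ a₃ ∩ (connEvent ends a₁ a₂)ᶜ).indicator 1 (restrict (touches ends P) ω)
    with hw
  have hw0 : ∀ ω, 0 ≤ w ω := fun ω =>
    mul_nonneg (weight_nonneg hp ω) (Set.indicator_apply_nonneg fun _ => zero_le_one)
  set Z := prob p (CutV.sideEvent (touches ends P)ᶜ (connEvent ends a₁ a₂)ᶜ) with hZ
  set Zf := prob p (CutV.sideEvent (touches ends P)ᶜ (connEvent ends a₂ o ∩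
    (connEvent ends a₁ a₂)ᶜ)) with hZf
  set X : Config E → R := fun ω => prob p (CutV.sideEvent (touches ends P)ᶜ
    (clusterInEvent ends a₁ {W | cluster ends (restrict (touches ends P) ω) a₁ ∪ W ∈ 𝓔} ∩
      connEvent ends a₂ o ∩ (connEvent ends a₁ a₂)ᶜ)) with hX
  set Y : Config E → R := fun ω => prob p (CutV.sideEvent (touches ends P)ᶜ
    (clusterInEvent ends a₁ {W | cluster ends (restrict (touches ends P) ω) a₁ ∪ W ∈ 𝓔} ∩
      (connEvent ends a₁ a₂)ᶜ)) with hY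
  have hfib : ∀ ω, X ω * Z ≤ Y ω * Zf := fun ω =>
    outside_anticorr p hp (CDCutVertex.isUpperSet_union_left h𝓔 _) o
  have hS0 : 0 ≤ ∑ ω, w ω := Finset.sum_nonneg fun ω _ => hw0 ω
  have sa : ∑ ω, weight p ω * ((connEvent ends a₁ a₃ ∩ (connEvent ends a₁ a₂)ᶜ).indicator 1
      (restrict (touches ends P) ω) * X ω) = ∑ ω, w ω * X ω :=
    Finset.sum_congr rfl fun ω _ => by rw [hw]; ring
  have sb : ∑ ω, weight p ω * ((connEvent ends a₁ a₃ ∩ (connEvent ends a₁ a₂)ᶜ).indicator 1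
      (restrict (touches ends P) ω) * Y ω) = ∑ ω, w ω * Y ω :=
    Finset.sum_congr rfl fun ω _ => by rw [hw]; ring
  have sd : ∑ ω, weight p ω * ((connEvent ends a₁ a₃ ∩ (connEvent ends a₁ a₂)ᶜ).indicator 1
      (restrict (touches ends P) ω) * Z) = (∑ ω, w ω) * Z := by
    rw [Finset.sum_mul]; exact Finset.sum_congr rfl fun ω _ => by rw [hw]; ring
  have sc : ∑ ω, weight p ω * ((connEvent ends a₁ a₃ ∩ (connEvent ends a₁ a₂)ᶜ).indicator 1
      (restrict (touches ends P) ω) * Zf) = (∑ ω, w ω) * Zf := by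
    rw [Finset.sum_mul]; exact Finset.sum_congr rfl fun ω _ => by rw [hw]; ring
  show (∑ ω, weight p ω * ((connEvent ends a₁ a₃ ∩ (connEvent ends a₁ a₂)ᶜ).indicator 1
      (restrict (touches ends P) ω) * X ω)) *
    (∑ ω, weight p ω * ((connEvent ends a₁ a₃ ∩ (connEvent ends a₁ a₂)ᶜ).indicator 1
      (restrict (touches ends P) ω) * Z)) ≤
    (∑ ω, weight p ω * ((connEvent ends a₁ a₃ ∩ (connEvent ends a₁ a₂)ᶜ).indicator 1
      (restrict (touches ends P) ω) * Y ω)) *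
    (∑ ω, weight p ω * ((connEvent ends a₁ a₃ ∩ (connEvent ends a₁ a₂)ᶜ).indicator 1
      (restrict (touches ends P) ω) * Zf))
  rw [sa, sb, sc, sd]
  have hsum : ∑ ω, w ω * (X ω * Z) ≤ ∑ ω, w ω * (Y ω * Zf) :=
    Finset.sum_le_sum fun ω _ => mul_le_mul_of_nonneg_left (hfib ω) (hw0 ω)
  have hXZ : ∑ ω, w ω * (X ω * Z) = (∑ ω, w ω * X ω) * Z := by
    rw [Finset.sum_mul]; exact Finset.sum_congr rfl fun ω _ => by ring
  have hYZ : ∑ ω, w ω * (Y ω * Zf) = (∑ ω, w ω * Y ω) * Zf := by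
    rw [Finset.sum_mul]; exact Finset.sum_congr rfl fun ω _ => by ring
  rw [hXZ, hYZ] at hsum
  calc (∑ ω, w ω * X ω) * ((∑ ω, w ω) * Z) = ((∑ ω, w ω * X ω) * Z) * ∑ ω, w ω := by ring
    _ ≤ ((∑ ω, w ω * Y ω) * Zf) * ∑ ω, w ω := mul_le_mul_of_nonneg_right hsum hS0
    _ = (∑ ω, w ω * Y ω) * ((∑ ω, w ω) * Zf) := by ring

/-- **Row 2′CD when `a₃` lies in a root-only pocket** (`PocketConn.IsPocket ends P a₁ a₂`, `a₃ ∈ P`,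
the roots and `o` outside): for every up-set `𝓔` and every weight vector,
`P(Q N)·(P(Q)P(Q U e f) − P(Q U)P(Q e f)) ≤ P(Q N oU)·(P(Q)P(Q U e) − P(Q U)P(Q e))`. -/
theorem cd_of_pocket (p : E → R) (hp : IsProbVec p) (hP : PocketConn.IsPocket ends P a₁ a₂)
    (h1 : a₁ ∉ P) (h2 : a₂ ∉ P) {a₃ o : V} (ha₃ : a₃ ∈ P) (ho : o ∉ P) {𝓔 : Set (Set V)}
    (h𝓔 : IsUpperSet 𝓔) :
    let Q := (connEvent ends a₁ a₂)ᶜ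
    let U := clusterInEvent ends a₁ 𝓔
    let e := connEvent ends a₁ a₃
    let f := connEvent ends a₂ o
    let N := (connEvent ends a₁ a₃)ᶜ ∩ (connEvent ends a₂ a₃)ᶜ
    let oU := connEvent ends a₁ o ∪ connEvent ends a₂ o
    prob p (Q ∩ N) * (prob p Q * prob p (Q ∩ U ∩ e ∩ f) - prob p (Q ∩ U) * prob p (Q ∩ e ∩ f)) ≤
      prob p (Q ∩ N ∩ oU) * (prob p Q * prob p (Q ∩ U ∩ e) - prob p (Q ∩ U) * prob p (Q ∩ e)) :=
  CDRequired.cd_of_required_anticorr p hp ends a₁ a₂ a₃ o h𝓔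
    (required_anticorr_of_pocket p hp hP h1 h2 ha₃ ho h𝓔)

end Main

end CDPocket

end Summit.Ventures.PercRepro2
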